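import Summits.MatrixMultiplication.OmegaCensus.STPPKernelListerOrderN53Z
import Summits.MatrixMultiplication.OmegaCensus.STPPVosperSlackTwoKill233233233Z53

/-!
# ω-census (abelian STPP census): `ℤ₅₃` admits no beating STPP family MODULO ONE PATTERN, `{(3,3,3),(3,3,3)}` (kernel)

HONEST FRAMING (pub-omega census; verbatim): lottery ticket; floor = certified bounds/negative ranges.
Census STRUCTURE (seat pub-omega-stpp-2 gen 31, 2026-08-29), family (b2).  `CubeNB.volume_le_card_zmod53_of_not_realizable` (`…OrderN53Z.lean`, stpp-2
g30) with its `233_233_233` hypothesis DISCHARGED by `notRealizable_Z53_233_233_233` (`STPPVosperSlackTwoKill233233233Z53.lean`, this seat): every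
simultaneous-triple-product family `(Aᵢ, Bᵢ, Cᵢ)_{i<m}` of `ℤ/53` (CKSU Def. 5.1; any `m`, any sizes) has `Σ |Aᵢ||Bᵢ||Cᵢ| ≤ 53` PROVIDED the one
remaining tree-law survivor `{(3,3,3),(3,3,3)}` (volume `54`, N18-slack `4` in every reading: `9 + 3 + 27 + 3 + 9 = 51 = 53 − 2`) is not realisable in `ℤ/53`.
That last pattern needs the slack-4 machinery of the ℤ₆₁ fifth leaf (`STPPVosperSlackFour*`, cells `δ ≤ 1` + the structure-free cell `(2,2)`), not run at
`p = 53`.  Census reading: ℤ₅₃ front 5/6 KERNEL-dead.  Nothing here is progress on `ω`.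
-/

open Finset

namespace Summit.MatrixMultiplication.OmegaCensus.CubeNB

open Literature.Computability.AlgebraicComplexity
open Summit.MatrixMultiplication.OmegaCensus.KLister

/-- **`ℤ₅₃`: no beating STPP family, modulo `{(3,3,3),(3,3,3)}`.**  If the size pattern `{(3,3,3),(3,3,3)}` has no STPP realisation in `ℤ/53`, then every
STPP family of `ℤ/53` has volume `Σ |Aᵢ||Bᵢ||Cᵢ| ≤ 53`. [cite: CohnKleinbergSzegedyUmans2005, Def. 5.1] -/
theorem volume_le_card_zmod53_of_not_realizable_333_333 (h333 : ¬ Realizable (ZMod 53) ([(3, 3, 3), (3, 3, 3)] : List Shape))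
    {m : ℕ} (A B C : Fin m → Finset (ZMod 53)) (hS : IsSTPP A B C) : ∑ i, #(A i) * #(B i) * #(C i) ≤ 53 :=
  volume_le_card_zmod53_of_not_realizable h333 notRealizable_Z53_233_233_233 A B C hS

end Summit.MatrixMultiplication.OmegaCensus.CubeNB
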